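import Mathlib
import HarnessLib
import HarnessLib.Audit
import Summits.Ventures.CertifiedManyBodySolver.HubbardAlg.MbsolverRungLeaves
import Summits.Ventures.CertifiedManyBodySolver.Upper.DressedBoxTilingTransport
import Literature.MathematicalPhysics.QuantumLattice.HubbardEnergyDensityChordBounds
import Literature.MathematicalPhysics.QuantumLattice.HubbardNNNHoppingOpenClusters

/-!
Route: R2cOpenStripTangentLine

# Route R2cOpenStripTangentLine — certified open-box families below the 1/8-doping tangent line
decide the R2c upper leaf

It suffices to show X = RightFamilyBelowLine ∧ LeftFamilyBelowLine: on EACH side of filling 7/8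
there is a certified, uniformly
affine ("all-k") family of OPEN t–t′ Hubbard clusters a × (k·b) at (t, t′, U) = (1, 0, 8) with k·N
electrons,
E_open(a × k·b; k·N) ≤ k·E + (k−1)·Δ for every k ≥ 1 (E, Δ ∈ ℚ; the shape every certified 2-D UPPER
row of the programme has, e.g.
CERTIFIED #354's claim node), whose k-free endpoint (E+Δ)/(ab) lies below the TANGENT LINE ℓ(n) =
−18/25 + (8/5)(n − 7/8) at its own
rational filling n = N/(ab), with n in the right window [7/8, 1] resp. the left window [3/4, 7/8]. A
single certified family at filling
exactly 7/8 with endpoint ≤ −18/25 (the LEAD's wording of the exit) discharges BOTH cruxes at once;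
families at other commensurate
fillings (cheaper column periods, number-indefinite-free) are admitted and combined by convexity of
e(n). No idea card (crew rung route).
Lean: `(∃ a b N : ℕ, ∃ E Δ : ℚ, 1 ≤ a ∧ 1 ≤ b ∧ (7 / 8 : ℚ) * ((a : ℚ) * (b : ℚ)) ≤ (N : ℚ) ∧ (N :
ℚ) ≤ (a : ℚ) * (b : ℚ) ∧ (E + Δ) / ((a : ℚ) * (b : ℚ)) ≤ -18 / 25 + 8 / 5 * ((N : ℚ) / ((a : ℚ) * (b
: ℚ)) - 7 / 8) ∧ ∀ k : ℕ, 1 ≤ k → Literature.MathematicalPhysics.QuantumLattice.groundEnergy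
(Literature.MathematicalPhysics.QuantumLattice.hubbardOpenBoxTT' a (k * b) 1 0 8) (k * N) ≤ ((((k :
ℚ) * E + ((k : ℚ) - 1) * Δ) : ℚ) : ℝ)) ∧ (∃ a b N : ℕ, ∃ E Δ : ℚ, 1 ≤ a ∧ 1 ≤ b ∧ (3 / 4 : ℚ) * ((a
: ℚ) * (b : ℚ)) ≤ (N : ℚ) ∧ (N : ℚ) ≤ (7 / 8 : ℚ) * ((a : ℚ) * (b : ℚ)) ∧ (E + Δ) / ((a : ℚ) * (b :
ℚ)) ≤ -18 / 25 + 8 / 5 * ((N : ℚ) / ((a : ℚ) * (b : ℚ)) - 7 / 8) ∧ ∀ k : ℕ, 1 ≤ k →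
Literature.MathematicalPhysics.QuantumLattice.groundEnergy
(Literature.MathematicalPhysics.QuantumLattice.hubbardOpenBoxTT' a (k * b) 1 0 8) (k * N) ≤ ((((k :
ℚ) * E + ((k : ℚ) - 1) * Δ) : ℚ) : ℝ))`

## Assembly
Standard reductions, sorry-free in the planner's Sketch.lean and rendered as the deciding theorem
`closes` (proved THROUGH the Assembly item so
every declared item is in its cone): each family gives e(1,0,8,n_i) ≤ (E_i+Δ_i)/(a_i b_i) ≤ ℓ(n_i)
by `energyDensityTT'_le_of_tiling_rat`
(N < 2ab follows from N ≤ ab); if n₁ = 7/8 or n₂ = 7/8 this is the leaf with hi = −18/25; otherwise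
n₁ < 7/8 < n₂ and
`energyDensityTT'_le_density_chord` gives e(7/8) ≤ ((n₂ − 7/8)ℓ(n₁) + (7/8 − n₁)ℓ(n₂))/(n₂ − n₁) =
−18/25 (`field_simp; ring`); the leaf's
witness is hi = −18/25.

CLOSES_TARGET: closes rung R2c of Ventures/CertifiedManyBodySolver: Summit.Ventures.CertifiedManyBodySolver.MbsolverRungLeaves.M3Upper_tp0_le_m18o25 (D-0061; not the summit Statement) — the deciding theorem of this route concludes that registered leaf (Ventures/CertifiedManyBodySolver: no summit Statement) (class rung: servable and labelled, never counted as concluding the summit Statement).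

Rationale: WHY THIS LINE. The leaf `M3Upper_tp0_le_m18o25` (∃ hi ≤ −18/25, e(1,0,8,7/8) ≤ hi) is a
thermodynamic-LIMIT statement; every certified UPPER exit of the programme is a FINITE object: an
explicit cluster state with an exactly (ℚ / interval) evaluated Rayleigh quotient, transported by
Ruelle's open-cluster pattern bound (Ruelle1969 §3.3; tree
`ThermodynamicLimit.energyDensityTT'_le_openBox`) and, for seam-dressed tilings uniform in the
number of copies, by `Upper.DressedBoxTiling.energyDensityTT'_le_of_tiling_rat` (FORMAT-dbt1,
CERTIFIED #354 = −99352233445291/2⁴⁷ = −0.70594 at (8,7/8,0)). The new move is to certify a LINE,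
not a point: e(n) is convex in the density (tree `convexOn_energyDensityTT'`,
`energyDensityTT'_le_density_chord`, Ruelle1969 §3.3–3.4), so two certified families below the
tangent line ℓ on either side of 7/8 bound e(7/8) by ℓ(7/8) = −18/25 exactly — the chord of an
affine function is itself. Slope 8/5 sits inside the float chord slopes of e at U = 8 [(e(7/8) −
e(4/5))/(3/40) ≈ 1.3, (e(1) − e(7/8))/(1/8) ≈ 1.9 from LeBlancEtAl2015 Table III / ZhengEtAl2017 /
QinEtAl2020, all FLOAT], so ℓ lies above the float curve on ≈ [0.75, 1.0] with the largest margin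
0.045 at 7/8 (float TL −0.7655, ZhengEtAl2017). Imported: convex analysis of the Legendre pair (e,
μ) (the same structure the LOWER side uses in `HubbardChemicalPotentialTL`); variational
tensor-network states as certificate producers (open-strip column MPS / BD-STRIP, wide open-box
DMRG, seam dressings). What no prior row does: reach −0.72 — the lineage-1 (width-4 ladder × box
tiling) ceiling is −0.71…−0.72 FLOAT (var TILING-CEILING v0.3); the cruxes name the object that must
beat it.

RANKED CRUXES. #2 RightFamilyBelowLine (crux) — there are a, b ≥ 1, N with 7/8 ≤ N/(ab) ≤ 1, and
rationals E, Δ with (E+Δ)/(ab) ≤ −18/25 + (8/5)(N/(ab) − 7/8), such that for every k ≥ 1 the open a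
× (k·b) t–t′ Hubbard cluster at (t,t′,U) = (1,0,8) with k·N electrons has ground energy ≤ k·E +
(k−1)·Δ (certified all-k family on the underdoped side, filling 7/8 included). [difficulty: XL] (why
it might fail: the bar −0.72 sits only 0.045 above the float TL (−0.7655, ZhengEtAl2017) while
certified open objects of width ≤ 6 lose ≥ 0.05/site to boundaries and truncation (TILING-CEILING
v0.3: lineage-1 ceiling −0.71…−0.72); if in truth e(1,0,8,7/8) > −0.72 the crux is false.)
[Ruelle1969, LeBlancEtAl2015, ZhengEtAl2017, QinEtAl2020, White2009] #3 LeftFamilyBelowLine (crux) —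
the same certified all-k open-cluster family on the overdoped side: a, b ≥ 1, N with 3/4 ≤ N/(ab) ≤
7/8, rationals E, Δ with (E+Δ)/(ab) ≤ −18/25 + (8/5)(N/(ab) − 7/8), and E_open(a × k·b; k·N) ≤ k·E +
(k−1)·Δ for every k ≥ 1 at (1,0,8). [difficulty: XL] (why it might fail: away from 7/8 the
admissible margin under ℓ shrinks (≈ 0.02 at n = 0.8, float LeBlancEtAl2015) and overdoped states
are more entangled (larger bond dimension per certified digit); at n = 7/8 it coincides with the
rank-2 crux and inherits its 0.045 margin problem.) [Ruelle1969, LeBlancEtAl2015, ZhengEtAl2017,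
doi:10.1063/1.2437650]

TWO-LAYER PLAN. Foreseen glued splits once producers name their object (nothing filed now):
RightFamilyBelowLine ⇐ StripBellmanCertificate → StripConsumer → RightFamilyBelowLine, where
StripBellmanCertificate = "a column-isometric MPS on the open width-w strip (w ∈ {6, 8}, period b
columns, U(1) charge k·N) with a positive-semidefinite Bellman/transfer dual witness (λ·1 − Y −
(Φ(Z) − Z) ⪰ 0, exact ℚ/ℤ Gram check as in `Upper.UMPSKernelCertificate`) and λ/(wb) ≤ ℓ(n)" and
StripConsumer = the 2-D analogue of Theorem U1 (`Upper.UMPSEnergyBound`): telescoping Σ_j tr(ρ_j Y)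
≤ k·λ + 2‖Z‖ gives exactly the affine all-k family (k ≤ 3 children, depth 1). Alternative child for
wide-box DMRG producers: SingleBoxRow (one certified open a × b box, Δ = 0 by undressed stacking) →
RightFamilyBelowLine. REGISTERED BC3 SKELETONS (2026-08-26, `ledger skeleton check`, evidence on
stmt-Ventures-19262/19263): per crux two stubs — `stub_spinCert{Right|Left}` = THE OBJECT in
Jordan–Wigner spin-side certificate form (∃ a b N, φ : TensorIndex (Fin a ×ₗ Fin b) 4 → ℂ supported
on site-charge N in the window, φ ≠ 0, Re⟨φ, toSpin(hubbardOpenBoxTT' a b 1 0 8) φ⟩ ≤ E·Re⟨φ,φ⟩,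
E/(ab) ≤ ℓ(N/(ab)); first object the 8 × 32 open strip at N = 224, FLOAT −0.742…−0.746 vs −0.72) and
`stub_boxSpinConsumer` = the in-kernel BOX CONSUMER (sentence ⇒ E_open(a × k·b; k·N) ≤ k·E for all k
≥ 1; JW transport + `LiebThm1.groundEnergy_mul_norm_le` + open stacking; the 2-D analogue of
`Upper.FMPSConsumer.hubbardChainEnergyDensityAt_le_of_spin_cert`, provable now); `<Crux>_of`
sorry-free with Δ = 0; BC3 probes 8/8 fail. S2 is filed as the route's SUPPORT item
`BoxSpinConsumer` (stmt-Ventures-19552, rank 9; known technique, provable now — the route's first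
prover target; the skeleton stubs are typed by its name), so the only open mathematics of each crux
is its object S1.

KILL CRITERIA. A certified LOWER row at (8,7/8,0) with lo > −18/25 (KSDN/SDP lineage; today's floor
is #473 = −0.8372, far below) refutes BOTH cruxes and the leaf itself — close
`refuted:RightFamilyBelowLine` and retire the rung as settled-false. A proof that every width-w
open-strip state loses ≥ c/w per site with c·(1/8) > 0.045 would not refute the cruxes (boxes of any
size are admitted) but kills the crew's planned producers — pivot to 2-D seam-correlated (BD-STRIP
K2 / PEPS-column) objects or park the route dormant. The leaf closed by any other certified row ≤
−18/25 (e.g. a future `M3Upper_tp0_le_…` instance theorem) moots the route: close `superseded`.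

NOT DECOMPOSED YET. Which object reaches −0.72 (w = 6 vs w = 8 open strips, seam-dressed 32 × 4k
tilings, column-MPS with 2-D seam correlations); the producer-side kernel theorems (StripConsumer,
charge-resolved column tensors → definite particle number, cf.
`Upper.FMPSConsumer.mpsOpenVar_eq_zero_of_charge`); the exact-arithmetic certification format for w
≥ 6 states (interval Rayleigh quotient vs Bellman dual); the slope (8/5) and windows are design
constants of this route, not claims about μ(7/8); t′ = −1/4 and the (8,1/2,0) edge are other leaves,
other routes.

CHEAPEST FALSIFIER. Lookup + arithmetic, run by this seat: (i) is any CERTIFIED row at (8, n, 0), n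
∈ [3/4, 1], already below ℓ(n)? No — at 7/8 the best certified upper is #354 = −0.70594 (bar −0.72;
missing 0.0141) and the RS row in refereeing forecasts −0.71199 (+0.008); the certified 2-D rows at
OTHER fillings inside the windows all sit ABOVE ℓ (CERTIFIED.md 2026-08-26; corrects rev 0, tribunal
T2/J feedback): #450 (8,3/4,0) open box −61045175247669/2⁴⁶ = −0.8675 vs ℓ(3/4) = −0.92 (+0.0525);
#446 (8,4/5,0) open box −0.8006 and #452 = FORMAT-dr1 chord(#450,#354) −141243879594149/(5·2⁴⁵) =
−0.8029 vs ℓ(4/5) = −0.84 (+0.0394 / +0.0371); #472 (8,1,0) −4475209735223/2⁴³ = −0.5088 vs ℓ(1) =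
−0.52 (+0.0112). (ii) does the float literature allow it? Yes: room under ℓ is 0.047 ± 0.004 at 7/8
(ZhengEtAl2017 −0.7655 multi-method), 0.037 at 4/5 and 0.047 at 3/4 (LeBlancEtAl2015 Tab. IV FN,
QinShiZhang2016), 0.005 at n = 1 — the line is certified-open, not float-dead, on [3/4, ≈ 0.95]. The
refuter's cheapest kill is a certified LOWER bound above −0.72 at 7/8 (none in sight: floor #473 =
−0.8372).

NUMBERS. Bar −18/25 = −0.72 (leaf). Certified cell of record at (8,7/8,0): [#473
−1012151804787154021296135/2⁸⁰ = −0.8372323499, #354 −99352233445291/2⁴⁷ = −0.7059400775]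
(CERTIFIED.md; tree modules `Certificates.HubbardSquare_n7o8_lower_row473`,
`…upper_dbt299pair_row354`). Float TL references (labelled FLOAT): e(1,0,8,7/8) ≈ −0.7655
(ZhengEtAl2017; LeBlancEtAl2015 −0.75…−0.77 by method), e(1,0,8,1) = −0.5234 (LeBlancEtAl2015,
QinEtAl2020), e(1,0,8,4/5) ≈ −0.86 (LeBlancEtAl2015). Lineage-1 ceiling −0.71…−0.72 FLOAT;
open-strip float ladder w = 4: −0.726, w = 6: −0.734…−0.739, w = 8: −0.742…−0.746 (var
TILING-CEILING v0.3 §2, R2c-ANNEX-var7 (ii); FLOAT). Cylinder wrap penalty ≥ |k_y|/w ≈ 0.05 at w = 8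
(TILING-CEILING §5(ii)) — why cylinders are anchors, not exits. MARGIN TABLE by commensurate filling
(certified distance ABOVE ℓ / FLOAT room UNDER ℓ; var-1 g18 l.18296): n = 3/4: 0.0525 (#450) /
0.0466 ± 0.0004 (CP-AFQMC −0.9666, QinShiZhang2016 Tab. III); 4/5: 0.0371 (#452) / 0.037 ± 0.001 (FN
−0.877, LeBlancEtAl2015 Tab. IV); 7/8: 0.0141 (#354; RS forecast 0.0080) / 0.047 ± 0.004 (−0.767,
ZhengEtAl2017); 15/16: — / ≈ 0.025 [est, convex interpolation]; 1: 0.0112 (#472) / 0.0047 ± 0.0002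
(AFQMC −0.5247); 3/5 and 1/2: ℓ lies BELOW e_float (room −0.087, −0.254) — outside. Reading: no
commensurate filling offers more float room than 7/8 (3/4 ties within error); the right window is
effectively [7/8, ≈ 0.95]; the off-7/8 chord is admitted freedom of commensurability (period-8
objects at 3/4, period-16 at 7/8) and has teeth only in `closes` (two off-7/8 objects n₁ < 7/8 < n₂,
each below ℓ, decide the 7/8 leaf though neither does alone), not a cheaper crossing — the direct
7/8 object remains the primary exit. Items at open: 3 (2 cruxes + assembly).

DEFINITION REQUESTS. None: `hubbardOpenBoxTT'`, `groundEnergy`, `energyDensityTT'`, the tiling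
transport and the density chord all exist in the tree.

Novelty: Searches (2026-08-26): `lit search --hybrid "rigorous variational upper bound ground state energy
density Hubbard model thermodynamic limit tensor network" -n 8` (8 docs: Essler2005 book,
Gubernatis2016, Xiang2023 TN book, arXiv:2511.20860 defect bootstrap — none a certified 2-D doped TL
upper); `lit search "Hubbard open boundary DMRG thermodynamic limit upper bound energy" --source
all` (crossref: Giuliani 2007 doi:10.1063/1.2437650 = rigorous LOW-density upper bound; openalex/s2
rate-limited 429); `lit galaxy search "variational upper bound|Hubbard model|energy density" --star
all -n 8` (24 rows, 0 relevant — substring noise); `lit frontier HubbardSuperconductivity --since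
2022` (bootstrap LOWER-bound papers arXiv:2506.18969, arXiv:2410.00810; no upper-side
certification); tree: `lean search --decl energyDensityTT'` (30 decls; chord, convexity, open-box
and tiling transports all landed). Nearest prior art found: the programme's own FORMAT-dbt1 rows
(CERTIFIED #354, tree `cert_dbt299pair_allk`) and its FORMAT-dr1 density-CHORD derived rows #444 /
#452 (chord of two certified uppers through `ThermodynamicLimit.energyDensity2D_le_density_chord` —
the convexity device of `closes` is already practised there, at 4/5, ABOVE ℓ); Ruelle1969 §3.3
(transport); the Maxwell-construction reading of e(n) vs n in stripe / phase-separation numerics —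
Hellberg–Manousakis PRL 78 (1997) 4609 = cond-mat/9611195 pp. 3–4 (Maxwell construction on
finite-cluster e(n)), Emery–Kivelson–Lin PRL 64 (19  [refs: 10.1063/1.2437650, 2511.20860, 2506.18969, 2410.00810, 2603.17856, 2608.10365, 2512.17713, doi:10.1063/1.2437650, Xiang2023, Ruelle1969, LeBlancEtAl2015, ZhengEtAl2017]

Barriers (technique_class: certified-upper-bound, cluster-tiling, convexity): - technique_class: certified-upper-bound, cluster-tiling, convexity
- Literature.Barriers.HubbardSuperconductivity.SignProblemNPHard: outside its class — no sampling;
the certificate is an explicit state with an exactly evaluated Rayleigh quotient (kernel / exact-ℚ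
readers), so NP-hardness of generic sign-free QMC does not quantify over it; the price is paid in
bond dimension, not in signs.
- Literature.Barriers.HubbardSuperconductivity.PureModelStripeCompetition: it does not bite an UPPER
bound's validity (any state bounds e from above); it explains the COST: stripe/uniform
near-degeneracy at (8, 1/8) is ~0.01t/site (QinEtAl2020), inside the 0.045 margin, so the
certificate need not resolve the competition — the bet is that a width-6/8 open-strip state
converged to 0.03/site exists at certifiable bond dimension.
- Literature.Barriers.HubbardSuperconductivity.OrderParameterInvisibleToGroundStateConstraints:
conceded and irrelevant — this route bounds an energy, claims no order parameter (HONEST FRAMING).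
- Negatives index: `ledger negatives --problem Ventures` is not served (Ventures is not one of the
21 summits); the sub's recorded refutations (tree `Conjectures/ToeplitzWindow*`,
`BandBottomBlindness`, `OneBodySection`) concern one-body / Toeplitz-window objects of the LOWER
programme; none concerns an (8, n, 0) certified UPPER family, and the cruxes restate none of them.

sub-problem: CertifiedManyBodySolver · status: open · opened planner-sr-mbsolver-var-7-g10-0 2026-08-26T03:24:28Z · rev 3 · ledger route-Ventures-R2cOpenStripTangentLine
GENERATED by the gate from the ledger (D-0016/17). Provers cite these decls: `theorem foo : Summit.Ventures.CertifiedManyBodySolver.Theses.R2cOpenStripTangentLine.<Decl> := …` in Summits/Ventures/CertifiedManyBodySolver/Theorems/<Name>.lean.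
-/

namespace Summit.Ventures.CertifiedManyBodySolver.Theses.R2cOpenStripTangentLine

open scoped BigOperators Topology Manifold Classical MeasureTheory ProbabilityTheory Matrix InnerProductSpace ComplexConjugate ContinuousMap
open Filter Set Function TopologicalSpace MeasureTheory

-- H21.Audit: Ventures rung route — no summit Statement decl; the expected conclusion is the closer leaf tagged below
attribute [summit_statement] _root_.Summit.Ventures.CertifiedManyBodySolver.MbsolverRungLeaves.M3Upper_tp0_le_m18o25

/-- item stmt-Ventures-19262 · crux · rank 2 · open · by planner
why it might fail: Bar −0.72 sits only 0.047±0.004 under the float TL (−0.7655, ZhengEtAl2017); certified floor #354 −0.7059 (+0.014), RS forecast −0.712; certifiable-D width-6/8 open strips forecast −0.70…−0.746 FLOAT, truncation at D≤4096 may eat the margin; false outright if e(1,0,8,7/8) > −0.72.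
sources: ZhengEtAl2017, LeBlancEtAl2015, Ruelle1969, QinEtAl2020, White2009
[crux] there are a, b ≥ 1, N with 7/8 ≤ N/(ab) ≤ 1, and rationals E, Δ with (E+Δ)/(ab) ≤ −18/25 +
(8/5)(N/(ab) − 7/8), such that for every k ≥ 1 the open a × (k·b) t–t′ Hubbard cluster at (t,t′,U) =
(1,0,8) with k·N electrons has ground energy ≤ k·E + (k−1)·Δ (certified all-k family on the
underdoped side, filling 7/8 included). [difficulty: XL] -/
@[route_item "route-Ventures-R2cOpenStripTangentLine"]
def RightFamilyBelowLine : Prop :=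
  ∃ a b N : ℕ, ∃ E Δ : ℚ, 1 ≤ a ∧ 1 ≤ b ∧ (7 / 8 : ℚ) * ((a : ℚ) * (b : ℚ)) ≤ (N : ℚ) ∧ (N : ℚ) ≤ (a : ℚ) * (b : ℚ) ∧ (E + Δ) / ((a : ℚ) * (b : ℚ)) ≤ -18 / 25 + 8 / 5 * ((N : ℚ) / ((a : ℚ) * (b : ℚ)) - 7 / 8) ∧ ∀ k : ℕ, 1 ≤ k → Literature.MathematicalPhysics.QuantumLattice.groundEnergy (Literature.MathematicalPhysics.QuantumLattice.hubbardOpenBoxTT' a (k * b) 1 0 8) (k * N) ≤ ((((k : ℚ) * E + ((k : ℚ) - 1) * Δ) : ℚ) : ℝ)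

/-- item stmt-Ventures-19263 · crux · rank 3 · open · by planner
why it might fail: No commensurate filling in [3/4,7/8] offers more float room under ℓ than 7/8 (3/4: 0.0466, 4/5: 0.037, 7/8: 0.047; var-1 g18); certified in-window rows #450/#452/#354 sit 0.0525/0.0371/0.0141 ABOVE ℓ; same certifiable-D truncation risk as the rank-2 crux; false if e > ℓ on the window.
sources: LeBlancEtAl2015, QinShiZhang2016, ZhengEtAl2017, Ruelle1969, doi:10.1063/1.2437650
[crux] the same certified all-k open-cluster family on the overdoped side: a, b ≥ 1, N with 3/4 ≤
N/(ab) ≤ 7/8, rationals E, Δ with (E+Δ)/(ab) ≤ −18/25 + (8/5)(N/(ab) − 7/8), and E_open(a × k·b;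
k·N) ≤ k·E + (k−1)·Δ for every k ≥ 1 at (1,0,8). [difficulty: XL] -/
@[route_item "route-Ventures-R2cOpenStripTangentLine"]
def LeftFamilyBelowLine : Prop :=
  ∃ a b N : ℕ, ∃ E Δ : ℚ, 1 ≤ a ∧ 1 ≤ b ∧ (3 / 4 : ℚ) * ((a : ℚ) * (b : ℚ)) ≤ (N : ℚ) ∧ (N : ℚ) ≤ (7 / 8 : ℚ) * ((a : ℚ) * (b : ℚ)) ∧ (E + Δ) / ((a : ℚ) * (b : ℚ)) ≤ -18 / 25 + 8 / 5 * ((N : ℚ) / ((a : ℚ) * (b : ℚ)) - 7 / 8) ∧ ∀ k : ℕ, 1 ≤ k → Literature.MathematicalPhysics.QuantumLattice.groundEnergy (Literature.MathematicalPhysics.QuantumLattice.hubbardOpenBoxTT' a (k * b) 1 0 8) (k * N) ≤ ((((k : ℚ) * E + ((k : ℚ) - 1) * Δ) : ℚ) : ℝ)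

/-- item stmt-Ventures-19552 · support · rank 9 · closed · proved by Summit.Ventures.CertifiedManyBodySolver.Theorems.boxSpinConsumer_proof (prover) · by planner
[support] In-kernel BOX CONSUMER — the 2-D analogue of
`Upper.FMPSConsumer.hubbardChainEnergyDensityAt_le_of_spin_cert`: for an open a × b box (a, b ≥ 1)
of the t–t′ Hubbard model at (t,t′,U) = (1,0,8) and N ≤ ab, every Jordan–Wigner spin-side vector φ :
TensorIndex (Fin a ×ₗ Fin b) 4 → ℂ supported on total site-charge N, nonzero, with Re⟨φ,
toSpin(H_open(a×b)) φ⟩ ≤ E·Re⟨φ,φ⟩ (E ∈ ℚ) yields the undressed all-k family E_open(a × k·b; k·N) ≤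
k·E for every k ≥ 1. Proof route (known technique, hence support not crux): JW dictionary
`JordanWigner.isNParticle_iff` / `expect_eq` / `star_toSpinVec_dotProduct` →
`LiebThm1.groundEnergy_mul_norm_le` (homogeneous variational principle) →
`groundEnergy_hubbardOpenBoxTT'_le_mul_openBox` with Kx = 1, Ky = k (N ≤ ab < 2ab) [Ruelle1969
§3.3]. It is the registered stub `stub_boxSpinConsumer` of BOTH BC3 birth skeletons
(stmt-Ventures-19262 / 19263): composed with the object stub `stub_spinCert{Right|Left}` it yields
the crux with Δ = 0. Provable now (≈ 40–60 lines, the 1-D proof transposes verbatim); the natural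
FIRST PROVER TARGET of the route. HONEST FRAMING: first certified bounds; not a superconductivity
verdict; every number certified or labell -/
@[route_item "route-Ventures-R2cOpenStripTangentLine"]
def BoxSpinConsumer : Prop :=
  ∀ (a b N : ℕ) (φ : Literature.MathematicalPhysics.QuantumLattice.TensorIndex (Fin a ×ₗ Fin b) 4 → ℂ) (E : ℚ), 1 ≤ a → 1 ≤ b → N ≤ a * b → (∀ k : Literature.MathematicalPhysics.QuantumLattice.TensorIndex (Fin a ×ₗ Fin b) 4, (∑ x, Literature.MathematicalPhysics.QuantumLattice.siteCharge (k x)) ≠ N → φ k = 0) → φ ≠ 0 → (star φ ⬝ᵥ (Literature.MathematicalPhysics.QuantumLattice.JordanWigner.toSpin (Literature.MathematicalPhysics.QuantumLattice.hubbardOpenBoxTT' a b 1 0 8) *ᵥ φ)).re ≤ (E : ℝ) * (star φ ⬝ᵥ φ).re → ∀ k : ℕ, 1 ≤ k → Literature.MathematicalPhysics.QuantumLattice.groundEnergy (Literature.MathematicalPhysics.QuantumLattice.hubbardOpenBoxTT' a (k * b) 1 0 8) (k * N) ≤ ((((k : ℚ) * E) : ℚ) : ℝ)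

-- `BoxSpinConsumer` holds: proved by `Summit.Ventures.CertifiedManyBodySolver.Theorems.boxSpinConsumer_proof` (its module imports this route file, so no `_holds` link can be stated here).

/-- item stmt-Ventures-19264 · assembly · rank 1 · closed · proved by Summit.Ventures.CertifiedManyBodySolver.Theorems.r2cAssembly_proof (prover) · by planner
sources: Ruelle1969
[assembly] RightFamilyBelowLine → LeftFamilyBelowLine → the rung-R2c leaf M3Upper_tp0_le_m18o25
(tiling transport + density convexity chord). -/
@[route_item "route-Ventures-R2cOpenStripTangentLine"]
def Assembly : Prop :=
  RightFamilyBelowLine → LeftFamilyBelowLine → Summit.Ventures.CertifiedManyBodySolver.MbsolverRungLeaves.M3Upper_tp0_le_m18o25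

-- `Assembly` holds: proved by `Summit.Ventures.CertifiedManyBodySolver.Theorems.r2cAssembly_proof` (its module imports this route file, so no `_holds` link can be stated here).

/-! D-0027 §2.1 — DECIDING THEOREM (planner-authored via `route open/edit --closes-file`; by planner-sr-mbsolver-var-7-g10-0 2026-08-26T03:24:28Z):
its hypotheses are this route's items and its conclusion the registered leaf `Summit.Ventures.CertifiedManyBodySolver.MbsolverRungLeaves.M3Upper_tp0_le_m18o25` (rung R2c, D-0061) (glue_lint), and it elaborates with this file. -/

@[closes "route-Ventures-R2cOpenStripTangentLine"] theorem closes (h₂ : RightFamilyBelowLine) (h₃ : LeftFamilyBelowLine) :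
    Summit.Ventures.CertifiedManyBodySolver.MbsolverRungLeaves.M3Upper_tp0_le_m18o25 := by
  have hA : Assembly := by
    intro hR hL
    -- the common exit: an all-`k` open-box family inside a density window, below the line
    -- `ℓ(n) = -18/25 + (8/5)(n - 7/8)`, gives `e(1,0,8,n) ≤ ℓ(n)` at its rational filling `n = N/(ab)`
    have hexit : ∀ (a b N : ℕ) (E Δ lo hi : ℚ), 1 ≤ a → 1 ≤ b → lo * ((a : ℚ) * (b : ℚ)) ≤ (N : ℚ) →
        (N : ℚ) ≤ hi * ((a : ℚ) * (b : ℚ)) → hi ≤ 1 →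
        (E + Δ) / ((a : ℚ) * (b : ℚ)) ≤ -18 / 25 + 8 / 5 * ((N : ℚ) / ((a : ℚ) * (b : ℚ)) - 7 / 8) →
        (∀ k : ℕ, 1 ≤ k → Literature.MathematicalPhysics.QuantumLattice.groundEnergy
          (Literature.MathematicalPhysics.QuantumLattice.hubbardOpenBoxTT' a (k * b) 1 0 8) (k * N) ≤
            ((((k : ℚ) * E + ((k : ℚ) - 1) * Δ) : ℚ) : ℝ)) →
        lo ≤ (N : ℚ) / ((a : ℚ) * (b : ℚ)) ∧ (N : ℚ) / ((a : ℚ) * (b : ℚ)) ≤ hi ∧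
          Literature.MathematicalPhysics.QuantumLattice.ThermodynamicLimit.energyDensityTT' 1 0 8
              (((N : ℚ) / ((a : ℚ) * (b : ℚ)) : ℚ) : ℝ) ≤
            ((-18 / 25 + 8 / 5 * ((N : ℚ) / ((a : ℚ) * (b : ℚ)) - 7 / 8) : ℚ) : ℝ) := by
      intro a b N E Δ lo hi ha hb hlo hhi hhi1 hline hfam
      have hab : (0 : ℚ) < (a : ℚ) * (b : ℚ) := by
        have ha' : (0 : ℚ) < a := by exact_mod_cast ha
        have hb' : (0 : ℚ) < b := by exact_mod_cast hb
        positivity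
      have hNle : (N : ℚ) ≤ (a : ℚ) * (b : ℚ) := hhi.trans (by nlinarith)
      have hN : N < 2 * (a * b) := by
        have h1 : N ≤ a * b := by exact_mod_cast hNle
        have h2 : 1 ≤ a * b := Nat.one_le_iff_ne_zero.mpr (Nat.mul_ne_zero (by omega) (by omega))
        omega
      refine ⟨by rwa [le_div_iff₀ hab], by rwa [div_le_iff₀ hab], ?_⟩
      have ht := Summit.Ventures.CertifiedManyBodySolver.Upper.DressedBoxTiling.energyDensityTT'_le_of_tiling_rat
        1 0 (U := 8) (by norm_num) ha hb hN E Δ hfam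
      have hcast : ((N : ℝ) / ((a : ℝ) * (b : ℝ))) = (((N : ℚ) / ((a : ℚ) * (b : ℚ)) : ℚ) : ℝ) := by
        push_cast; rfl
      rw [hcast] at ht
      refine ht.trans ?_
      exact_mod_cast hline
    obtain ⟨a₂, b₂, N₂, E₂, Δ₂, ha₂, hb₂, hlo₂, hhi₂, hline₂, hfam₂⟩ := hR
    obtain ⟨a₁, b₁, N₁, E₁, Δ₁, ha₁, hb₁, hlo₁, hhi₁, hline₁, hfam₁⟩ := hL
    have hhi₂' : (N₂ : ℚ) ≤ 1 * ((a₂ : ℚ) * (b₂ : ℚ)) := by rwa [one_mul]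
    obtain ⟨hl₂, hr₂, he₂⟩ := hexit a₂ b₂ N₂ E₂ Δ₂ (7 / 8) 1 ha₂ hb₂ hlo₂ hhi₂' le_rfl hline₂ hfam₂
    obtain ⟨hl₁, hr₁, he₁⟩ := hexit a₁ b₁ N₁ E₁ Δ₁ (3 / 4) (7 / 8) ha₁ hb₁ hlo₁ hhi₁ (by norm_num) hline₁ hfam₁
    -- work over ℝ with the two fillings `n₁ ≤ 7/8 ≤ n₂` and the line values `u_i = ℓ(n_i)`
    set n₂ : ℚ := (N₂ : ℚ) / ((a₂ : ℚ) * (b₂ : ℚ)) with hn₂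
    set n₁ : ℚ := (N₁ : ℚ) / ((a₁ : ℚ) * (b₁ : ℚ)) with hn₁
    refine ⟨-18 / 25, le_rfl, ?_⟩
    show Literature.MathematicalPhysics.QuantumLattice.ThermodynamicLimit.energyDensityTT' 1 0 8 (7 / 8) ≤
      (((-18 / 25 : ℚ) : ℚ) : ℝ)
    rcases eq_or_lt_of_le hl₂ with h78 | hlt₂
    · -- the right family sits exactly at filling 7/8
      have : ((n₂ : ℚ) : ℝ) = 7 / 8 := by rw [← h78]; push_cast; ring
      rw [this] at he₂
      refine he₂.trans_eq ?_
      rw [← h78]; push_cast; ring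
    rcases eq_or_lt_of_le hr₁ with h78 | hlt₁
    · -- the left family sits exactly at filling 7/8
      have : ((n₁ : ℚ) : ℝ) = 7 / 8 := by rw [h78]; push_cast; ring
      rw [this] at he₁
      refine he₁.trans_eq ?_
      rw [h78]; push_cast; ring
    -- `n₁ < 7/8 < n₂`: convexity of `e` in the density (the chord of the affine `ℓ` is `ℓ` itself)
    have hc := Literature.MathematicalPhysics.QuantumLattice.ThermodynamicLimit.energyDensityTT'_le_density_chord
      1 0 (U := 8) (by norm_num) (n₁ := ((n₁ : ℚ) : ℝ)) (n := (7 / 8 : ℝ)) (n₂ := ((n₂ : ℚ) : ℝ))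
      (by have : (3 / 4 : ℚ) ≤ n₁ := hl₁
          have h0 : (0 : ℚ) ≤ n₁ := le_trans (by norm_num) this
          exact_mod_cast h0)
      (by have h : ((n₁ : ℚ) : ℝ) < ((7 / 8 : ℚ) : ℝ) := Rat.cast_lt.mpr hlt₁
          norm_num at h; exact h)
      (by have h : ((7 / 8 : ℚ) : ℝ) < ((n₂ : ℚ) : ℝ) := Rat.cast_lt.mpr hlt₂
          norm_num at h; exact h)
      (by have : n₂ ≤ (1 : ℚ) := hr₂
          have h2 : n₂ < (2 : ℚ) := lt_of_le_of_lt this (by norm_num)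
          exact_mod_cast h2)
      he₁ he₂
    refine hc.trans_eq ?_
    have hne : ((n₂ : ℚ) : ℝ) - ((n₁ : ℚ) : ℝ) ≠ 0 := by
      have : ((n₁ : ℚ) : ℝ) < ((n₂ : ℚ) : ℝ) := by exact_mod_cast (hlt₁.trans hlt₂)
      linarith
    rw [div_eq_iff hne]
    push_cast
    ring
  exact hA h₂ h₃

end Summit.Ventures.CertifiedManyBodySolver.Theses.R2cOpenStripTangentLine
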